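import Literature.MathematicalPhysics.QuantumFieldTheory.Balaban1983to89.Node00.DressedSlotsOfRecord
import Literature.MathematicalPhysics.QuantumFieldTheory.Balaban1983to89.Node00.Record12

/-!
# NODE 00 — THE DRESSED SLOT FAMILY OF RECORD RE-KEYED AT STAGE 12: F3's dressed (2.18) slots ∕ densities ∕ class weights TYPED OVER THE STAGE-9 PART of the
# parameter tuple (what F3's Stage-11 versions actually read), and their specialisation AT THE STAGE-12 RECORD `Node00.datumOfRecord₁₂` — E1 at level 0 at
# the ₁₂ record as a SUM identity with NO hypothesis

Cell `pub-ymgap`, YM-PLAN Track A (HUMAN RULING D-0062); author seat `pub-ymgap-dag-n20-d` (g2), the live seat of the N20 lineage, on director-ym LINE №81 (3)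
«every ₁₁ module re-instantiates at the Stage-12 record» (dag-lead DEDUP-166 ∕ -171: the N20 ₁₂ re-key is this seat's).  The ₁₂ RE-KEY of dag-n20-e's F3
`Node00/DressedSlotsOfRecord.lean` (p457327).  [III] = [Balaban1988Convergent], [IV] = [Balaban1989LargeFieldI].

WHY.  F3's record-keyed objects `dressedSlotsOfRecord₁₁ ∕ dressedDensityOfRecord₁₁ ∕ classWeightOfRecord₁₁`, `integrable_dressedStart_datumOfRecord₁₁` and the
level-0 E1 identity `sum_classWeightOfRecord₁₁_zero` all take a proof `hP : θ.Provisos₁₁` of 11d's displayed provisos — which def-T's Stage 12 located to be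
UNINHABITED (`Node00.not_provisos₁₁`, `Node00/Record12.lean`): they are UNKEYABLE.  F3's datum-started objects `dressedSlotsOfDatum₁₁ θ D …` take `θ :
Stage11Params` but READ ONLY ITS STAGE-9 PART — the Stage-7 numerics `θ.ν`, def-R's tower numerics `θ.τ9`, the selection `θ.ppSel`, the step weights
`wOfRecord₉ θ.toStage9Params` and the R-slot operation `rstepSlotOfRecord θ.ν θ.τ9 θ.ppSel`.  So the honest re-key is: (§1) type the dressed objects over
`ϑ : Stage9Params` (F3's bodies VERBATIM with `θ ↦ ϑ`; F3's Stage-11 objects ARE these at `θ.toStage9Params`, `rfl` — the philosophy of node00-def-RR-2's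
`SpineAssignment₁₂.ofStage9`), and (§2) specialise at the Stage-12 record through `θ.toStage9Params` and `Node00.datumOfRecord₁₂ F N θ hP` (`hP : θ.Provisos₁₂ F N`),
where B1 holds by def-T's `isPrintedAveraged_datumOfRecord₁₂` — so that E1 AT LEVEL 0 is again a theorem AT THE RECORD with no hypothesis
(`sum_classWeightOfRecord₁₂_zero`).  Nothing is routed through the Stage-11 view's (absent) provisos; the view `θ.toStage11 F N p₁` enters only in the
`rfl` face `dressedSlotsOfRecord₁₂_eq_ofDatum₁₁_view` (its residual `Wt` is not read by F3's objects).

WHAT IS DEFINED ∕ PROVED (definitions of record + kernel bookkeeping; every face `rfl`, F3's three-line `eval_zero`, or F3's (e1) proof verbatim).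
* §1 `dressedSlotsOfDatum₉ ϑ D g₀ os t` · `dressedSlotsOfDatum₉_zero` · `dressedSlotsOfDatum₁₁_eq_ofDatum₉` · `dressedDensityOfDatum₉` · `dressedDensityOfDatum₁₁_eq_ofDatum₉` ·
  `dressedDensityOfDatum₉_zero` · `integral_dressedDensityOfDatum₉_zero` (E1 at level 0, ANY datum) · `classWeightOfDatum₉` · `classWeightOfDatum₁₁_eq_ofDatum₉` ·
  `sum_chi_mul_dressedSlots₉_eq` · `sum_classWeightOfDatum₉_eq_integral` ((e1) under DISPLAYED integrability) · `sum_classWeightOfDatum₉_zero` (E1 at level 0 as a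
  SUM identity under `D.AvgMeasurable`).
* §2 `integrable_dressedStart_datumOfRecord₁₂` (NO hypothesis) · `dressedSlotsOfRecord₁₂ θ hP` · `dressedSlotsOfRecord₁₂_eq` · `dressedSlotsOfRecord₁₂_zero` ·
  `dressedSlotsOfRecord₁₂_eq_ofDatum₁₁_view` · `dressedDensityOfRecord₁₂` · `dressedDensityOfRecord₁₂_zero` · `integral_dressedDensityOfRecord₁₂_zero` ·
  `classWeightOfRecord₁₂` · **`sum_classWeightOfRecord₁₂_zero`** (E1 AT LEVEL 0 AT THE STAGE-12 RECORD, NO hypothesis).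

HONEST FRAMING — what this is NOT.  OBJECTS and `rfl`-grade faces only.  E1 BEYOND LEVEL 0 ((e1) integrability of the dressed pieces at `k ≥ 1`, (e2) the
(0.4) telescoping of def-T's T-step and def-R's R-step ON THE DRESSED FAMILY) and node U5d's run-B truncation are NOT here — exactly as F3's header locates
them.  No bad set, no shell split, no weight slot (they are the Summits-side READING's, `YMDAG.UVSplit.SpineReading₁₂`).  Nothing of Bałaban's is asserted:
[III] Thms 1–2, (2.19)–(2.44), [IV] (1.1)–(1.2), NE7 ∕ NE7b ∕ NE7c (NOT PRINTED for d = 4) are neither stated nor used; no inhabitant of `IsRecordOfRecord₁₂C`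
is claimed (K0′ open); no node count moves (typed 28∕28 · discharged 5∕28); `--supports` K0 (stmt-QuantumFields-19673) as a NODE 00 object module.  No
`sorry`, no `axiom`, no `opaque`, no `instance`, no `notation`, no attribute removed.  One finite four-torus programme at fixed `ε` — NOT the continuum limit
on ℝ⁴, NOT infinite volume, NOT OS, NOT a mass gap, NOT the Clay problem.
-/

noncomputable section

open MeasureTheory

namespace Literature.MathematicalPhysics.QuantumFieldTheory.Balaban1983to89.Node00

open T4Continuum

variable (F : T4Family) (N : ℕ) [NeZero N]

/-! ## §1 The dressed objects typed over the Stage-9 part of the tuple -/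

/-- **THE DRESSED SLOT FAMILY of the Stage-9 tuple `ϑ` STARTED AT THE DATUM `D`**: the start-generic recursion of record (F3 `texpAOfRecordFrom`) from the dressed
start `e^{t·F_K}·e^{−A∕g₀(K)²}` of `D`'s Wilson scheme, with `ϑ`'s step weights `wOfRecord₉ ϑ` and R-slot operation `rstepSlotOfRecord ϑ.ν ϑ.τ9 ϑ.ppSel` —
F3's `dressedSlotsOfDatum₁₁` with the (unread) Stage-11 fields dropped from the signature. [cite: Balaban1988Convergent, (2.18) p.257, (3.24)–(3.25) p.270; Balaban1989LargeFieldI, (0.3) p.176 (bookkeeping)] -/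
def dressedSlotsOfDatum₉ (ϑ : Stage9Params F N) (D : FiniteEpsData F (SU N)) (g₀ : ℕ → ℝ) (os : List (ULoop F)) (t : ℝ) :
    TexpAOfRecord F N ϑ.ν ϑ.τ9.M :=
  texpAOfRecordFrom F N ϑ.ν ϑ.τ9.M (fun p _ => dressedStart F N D g₀ os t p) (wOfRecord₉ F N ϑ) (rstepSlotOfRecord F N ϑ.ν ϑ.τ9 ϑ.ppSel)

/-- Level 0 of the dressed slots IS the dressed start, on every length-0 sequence (`rfl`). [cite: Balaban1988Convergent, (2.18) p.257 (bookkeeping)] -/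
theorem dressedSlotsOfDatum₉_zero (ϑ : Stage9Params F N) (D : FiniteEpsData F (SU N)) (g₀ : ℕ → ℝ) (os : List (ULoop F)) (t : ℝ)
    (p : B12.RunParams) (g : ℕ → ℝ) (s : SeqOfRecord F ϑ.ν ϑ.τ9.M g p.K 0) :
    dressedSlotsOfDatum₉ F N ϑ D g₀ os t p g 0 s = dressedStart F N D g₀ os t p := rfl

/-- **F3's STAGE-11 OBJECT IS THE STAGE-9 ONE at `θ.toStage9Params`** (`rfl`: the Stage-11 fields `s2 ∕ Rz ∕ Wt` are not read).
[cite: Balaban1988Convergent, (2.18) p.257 (bookkeeping)] -/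
theorem dressedSlotsOfDatum₁₁_eq_ofDatum₉ (θ : Stage11Params F N) (D : FiniteEpsData F (SU N)) (g₀ : ℕ → ℝ) (os : List (ULoop F)) (t : ℝ) :
    dressedSlotsOfDatum₁₁ F N θ D g₀ os t = dressedSlotsOfDatum₉ F N θ.toStage9Params D g₀ os t := rfl

/-- **THE DRESSED DENSITIES** of the Stage-9 tuple started at `D`, after `k` steps: the (2.18) assembly `Σ_{s : SeqOfRecord} χ_k(s)·slot^{t,os}_k(s)` of the
dressed slots over the record's OWN sequence index (`densityOfRepr`). [cite: Balaban1988Convergent, (2.18) p.257 (bookkeeping)] -/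
def dressedDensityOfDatum₉ (ϑ : Stage9Params F N) (D : FiniteEpsData F (SU N)) (g₀ : ℕ → ℝ) (os : List (ULoop F)) (t : ℝ)
    (p : B12.RunParams) (g : ℕ → ℝ) (k : ℕ) : Density (F.P p.K) k (SU N) :=
  densityOfRepr F N ϑ.ν ϑ.τ9.M (dressedSlotsOfDatum₉ F N ϑ D g₀ os t) p g k

/-- F3's Stage-11 dressed density IS the Stage-9 one at `θ.toStage9Params` (`rfl`). [cite: Balaban1988Convergent, (2.18) p.257 (bookkeeping)] -/
theorem dressedDensityOfDatum₁₁_eq_ofDatum₉ (θ : Stage11Params F N) (D : FiniteEpsData F (SU N)) (g₀ : ℕ → ℝ) (os : List (ULoop F)) (t : ℝ)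
    (p : B12.RunParams) (g : ℕ → ℝ) (k : ℕ) :
    dressedDensityOfDatum₁₁ F N θ D g₀ os t p g k = dressedDensityOfDatum₉ F N θ.toStage9Params D g₀ os t p g k := rfl

/-- At step 0 the dressed density IS the dressed start (F3 §1 `eval_zero`). [cite: Balaban1988Convergent, (2.18) p.257, Thm 1 p.262 (bookkeeping)] -/
theorem dressedDensityOfDatum₉_zero (ϑ : Stage9Params F N) (D : FiniteEpsData F (SU N)) (g₀ : ℕ → ℝ) (os : List (ULoop F)) (t : ℝ)
    (p : B12.RunParams) (g : ℕ → ℝ) : dressedDensityOfDatum₉ F N ϑ D g₀ os t p g 0 = dressedStart F N D g₀ os t p :=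
  densityOfRepr_texpAOfRecordFrom_zero F N ϑ.ν ϑ.τ9.M _ _ _ p g

/-- **E1 AT LEVEL 0, ANY DATUM**: the dressed density at step 0 integrates to the scheme's dressed partition function `schemeZ (D.scheme g₀) os p.K t` — no
hypothesis (F3 `integral_dressedStart` is `rfl`). [cite: Balaban1985UV3, (6) p.257; King1986, (3.10) p.656 (bookkeeping)] -/
theorem integral_dressedDensityOfDatum₉_zero (ϑ : Stage9Params F N) (D : FiniteEpsData F (SU N)) (g₀ : ℕ → ℝ) (os : List (ULoop F)) (t : ℝ)
    (p : B12.RunParams) (g : ℕ → ℝ) :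
    ∫ V, dressedDensityOfDatum₉ F N ϑ D g₀ os t p g 0 V ∂fieldMeasure (F.P p.K) 0 (SU N) = T4GenFunBounds.schemeZ (D.scheme g₀) os p.K t := by
  rw [dressedDensityOfDatum₉_zero]
  rfl

/-- **THE CLASS WEIGHT OF ONE SEQUENCE** at the source `t`: `∫ χ_k(s)(V)·slot^{t,os}_k(s)(V) dV_k` — run A's term weight of a spine reading of this family at
`p = ⟨K₀ + K, F.m, g₀ (K₀ + K)⟩`, `k = K₀ + K` (the reading itself is Summits-side). [cite: Balaban1988Convergent, (2.18) p.257; King1986, (3.10) p.656 (bookkeeping)] -/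
def classWeightOfDatum₉ (ϑ : Stage9Params F N) (D : FiniteEpsData F (SU N)) (g₀ : ℕ → ℝ) (os : List (ULoop F)) (p : B12.RunParams)
    (g : ℕ → ℝ) (k : ℕ) (t : ℝ) (s : SeqOfRecord F ϑ.ν ϑ.τ9.M g p.K k) : ℝ :=
  ∫ V, chiSeqOfRecord F N ϑ.ν ϑ.τ9.M g p.K k s V * dressedSlotsOfDatum₉ F N ϑ D g₀ os t p g k s V ∂fieldMeasure (F.P p.K) k (SU N)

/-- F3's Stage-11 class weight IS the Stage-9 one at `θ.toStage9Params` (`rfl`). [cite: Balaban1988Convergent, (2.18) p.257 (bookkeeping)] -/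
theorem classWeightOfDatum₁₁_eq_ofDatum₉ (θ : Stage11Params F N) (D : FiniteEpsData F (SU N)) (g₀ : ℕ → ℝ) (os : List (ULoop F)) (p : B12.RunParams)
    (g : ℕ → ℝ) (k : ℕ) (t : ℝ) (s : SeqOfRecord F θ.ν θ.τ9.M g p.K k) :
    classWeightOfDatum₁₁ F N θ D g₀ os p g k t s = classWeightOfDatum₉ F N θ.toStage9Params D g₀ os p g k t s := rfl

/-- **THE PIECEWISE INTEGRAND SUMS TO THE DRESSED DENSITY** (pointwise, finite sum — the integrand side of (e1)). [cite: Balaban1988Convergent, (2.18) p.257 (bookkeeping)] -/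
theorem sum_chi_mul_dressedSlots₉_eq (ϑ : Stage9Params F N) (D : FiniteEpsData F (SU N)) (g₀ : ℕ → ℝ) (os : List (ULoop F)) (t : ℝ)
    (p : B12.RunParams) (g : ℕ → ℝ) (k : ℕ) (V : GaugeField (F.P p.K) k (SU N)) :
    ∑ s : SeqOfRecord F ϑ.ν ϑ.τ9.M g p.K k, chiSeqOfRecord F N ϑ.ν ϑ.τ9.M g p.K k s V * dressedSlotsOfDatum₉ F N ϑ D g₀ os t p g k s V =
      dressedDensityOfDatum₉ F N ϑ D g₀ os t p g k V := rfl

/-- **(e1) UNDER DISPLAYED INTEGRABILITY**: if every piece `χ_k(s)·slot^{t,os}_k(s)` is integrable (hypothesis), the class weights sum to the integral of the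
dressed density at step `k` (F3's proof verbatim). [cite: Balaban1988Convergent, (2.18) p.257 (bookkeeping)] -/
theorem sum_classWeightOfDatum₉_eq_integral (ϑ : Stage9Params F N) (D : FiniteEpsData F (SU N)) (g₀ : ℕ → ℝ) (os : List (ULoop F)) (t : ℝ)
    (p : B12.RunParams) (g : ℕ → ℝ) (k : ℕ)
    (hint : ∀ s : SeqOfRecord F ϑ.ν ϑ.τ9.M g p.K k,
      Integrable (fun V => chiSeqOfRecord F N ϑ.ν ϑ.τ9.M g p.K k s V * dressedSlotsOfDatum₉ F N ϑ D g₀ os t p g k s V)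
        (fieldMeasure (F.P p.K) k (SU N))) :
    ∑ s : SeqOfRecord F ϑ.ν ϑ.τ9.M g p.K k, classWeightOfDatum₉ F N ϑ D g₀ os p g k t s =
      ∫ V, dressedDensityOfDatum₉ F N ϑ D g₀ os t p g k V ∂fieldMeasure (F.P p.K) k (SU N) := by
  unfold classWeightOfDatum₉
  rw [← integral_finsetSum Finset.univ (fun s _ => hint s)]
  rfl

/-- **E1 AT LEVEL 0 AS A SUM IDENTITY, ANY DATUM WITH MEASURABLE AVERAGING**: under `D.AvgMeasurable` the class weights of the (length-0) sequences sum to the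
scheme's dressed partition function (integrability at level 0 by F3 `integrable_dressedStart` and `χ_0 ≡ 1`). [cite: Balaban1985UV3, (6) p.257; King1986, (3.10) p.656 (bookkeeping)] -/
theorem sum_classWeightOfDatum₉_zero (ϑ : Stage9Params F N) (D : FiniteEpsData F (SU N)) (hM : D.AvgMeasurable) (g₀ : ℕ → ℝ) (os : List (ULoop F))
    (t : ℝ) (p : B12.RunParams) (g : ℕ → ℝ) :
    ∑ s : SeqOfRecord F ϑ.ν ϑ.τ9.M g p.K 0, classWeightOfDatum₉ F N ϑ D g₀ os p g 0 t s = T4GenFunBounds.schemeZ (D.scheme g₀) os p.K t := by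
  rw [sum_classWeightOfDatum₉_eq_integral, integral_dressedDensityOfDatum₉_zero]
  intro s
  have h : (fun V => chiSeqOfRecord F N ϑ.ν ϑ.τ9.M g p.K 0 s V * dressedSlotsOfDatum₉ F N ϑ D g₀ os t p g 0 s V) = dressedStart F N D g₀ os t p := by
    funext V
    rw [chiSeqOfRecord_zero, one_mul]
    rfl
  rw [h]
  exact integrable_dressedStart F N D hM g₀ os t p

/-! ## §2 At the Stage-12 record `Node00.datumOfRecord₁₂ F N θ hP` -/

/-- **THE DRESSED START IS INTEGRABLE AT EVERY STAGE-12 DATUM OF RECORD — NO hypothesis** (B1: def-T's `isPrintedAveraged_datumOfRecord₁₂` ⇒ `AvgMeasurable`;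
then F3 `integrable_dressedStart`).  The ₁₂ twin of F3's now unkeyable `integrable_dressedStart_datumOfRecord₁₁`. [cite: Balaban1989LargeFieldII, Thm 1 p.355 (bookkeeping)] -/
theorem integrable_dressedStart_datumOfRecord₁₂ (θ : Stage12Params F N) (hP : θ.Provisos₁₂ F N) (g₀ : ℕ → ℝ) (os : List (ULoop F)) (t : ℝ)
    (p : B12.RunParams) :
    Integrable (dressedStart F N (datumOfRecord₁₂ F N θ hP) g₀ os t p) (fieldMeasure (F.P p.K) 0 (SU N)) :=
  integrable_dressedStart F N _ (isPrintedAveraged_datumOfRecord₁₂ F N θ hP).avgMeasurable g₀ os t p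

/-- **THE DRESSED SLOT FAMILY OF RECORD, STAGE 12**: the Stage-9 part of an admissible-with-provisos Stage-12 tuple supplies the STEPS, its own datum of record
`datumOfRecord₁₂ F N θ hP` the START. [cite: Balaban1988Convergent, (2.18) p.257; Balaban1989LargeFieldII, Thm 1 + (0.1) pp.355–356 (bookkeeping)] -/
def dressedSlotsOfRecord₁₂ (θ : Stage12Params F N) (hP : θ.Provisos₁₂ F N) (g₀ : ℕ → ℝ) (os : List (ULoop F)) (t : ℝ) :
    TexpAOfRecord F N θ.ν θ.τ9.M :=
  dressedSlotsOfDatum₉ F N θ.toStage9Params (datumOfRecord₁₂ F N θ hP) g₀ os t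

/-- Face (`rfl`): the record's dressed slots are the Stage-9-started ones at its own datum. [cite: Balaban1989LargeFieldII, Thm 1 p.355 (bookkeeping)] -/
theorem dressedSlotsOfRecord₁₂_eq (θ : Stage12Params F N) (hP : θ.Provisos₁₂ F N) (g₀ : ℕ → ℝ) (os : List (ULoop F)) (t : ℝ) :
    dressedSlotsOfRecord₁₂ F N θ hP g₀ os t = dressedSlotsOfDatum₉ F N θ.toStage9Params (datumOfRecord₁₂ F N θ hP) g₀ os t := rfl

/-- Level 0 of the record's dressed slots IS the dressed start of its datum (`rfl`). [cite: Balaban1988Convergent, (2.18) p.257 (bookkeeping)] -/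
theorem dressedSlotsOfRecord₁₂_zero (θ : Stage12Params F N) (hP : θ.Provisos₁₂ F N) (g₀ : ℕ → ℝ) (os : List (ULoop F)) (t : ℝ)
    (p : B12.RunParams) (g : ℕ → ℝ) (s : SeqOfRecord F θ.ν θ.τ9.M g p.K 0) :
    dressedSlotsOfRecord₁₂ F N θ hP g₀ os t p g 0 s = dressedStart F N (datumOfRecord₁₂ F N θ hP) g₀ os t p := rfl

/-- **RELATION TO F3 THROUGH def-T's STAGE-11 VIEW**: for ANY run `p₁`, the record's dressed slots ARE F3's `dressedSlotsOfDatum₁₁` of the view `θ.toStage11 F N p₁`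
started at the Stage-12 datum (`rfl`; the view's re-bound weights `Wt` are not read, and NO provisos of the view are involved — it has none).
[cite: Balaban1988Convergent, (2.18) p.257, (2.21) p.258 (bookkeeping)] -/
theorem dressedSlotsOfRecord₁₂_eq_ofDatum₁₁_view (θ : Stage12Params F N) (hP : θ.Provisos₁₂ F N) (g₀ : ℕ → ℝ) (os : List (ULoop F)) (t : ℝ)
    (p₁ : B12.RunParams) :
    dressedSlotsOfRecord₁₂ F N θ hP g₀ os t = dressedSlotsOfDatum₁₁ F N (θ.toStage11 F N p₁) (datumOfRecord₁₂ F N θ hP) g₀ os t := rfl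

/-- **THE DRESSED DENSITIES OF RECORD, STAGE 12** (the (2.18) assembly of the record's dressed slots over its own sequence index).
[cite: Balaban1988Convergent, (2.18) p.257; Balaban1989LargeFieldII, Thm 1 p.355 (bookkeeping)] -/
def dressedDensityOfRecord₁₂ (θ : Stage12Params F N) (hP : θ.Provisos₁₂ F N) (g₀ : ℕ → ℝ) (os : List (ULoop F)) (t : ℝ)
    (p : B12.RunParams) (g : ℕ → ℝ) (k : ℕ) : Density (F.P p.K) k (SU N) :=
  dressedDensityOfDatum₉ F N θ.toStage9Params (datumOfRecord₁₂ F N θ hP) g₀ os t p g k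

/-- At step 0 the record's dressed density IS the dressed start of its datum. [cite: Balaban1988Convergent, (2.18) p.257, Thm 1 p.262 (bookkeeping)] -/
theorem dressedDensityOfRecord₁₂_zero (θ : Stage12Params F N) (hP : θ.Provisos₁₂ F N) (g₀ : ℕ → ℝ) (os : List (ULoop F)) (t : ℝ)
    (p : B12.RunParams) (g : ℕ → ℝ) :
    dressedDensityOfRecord₁₂ F N θ hP g₀ os t p g 0 = dressedStart F N (datumOfRecord₁₂ F N θ hP) g₀ os t p :=
  dressedDensityOfDatum₉_zero F N θ.toStage9Params _ g₀ os t p g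

/-- **E1 AT LEVEL 0 AT THE STAGE-12 RECORD**: the record's dressed density at step 0 integrates to the dressed partition function
`schemeZ ((datumOfRecord₁₂ F N θ hP).scheme g₀) os p.K t` of its own datum's Wilson scheme — no hypothesis. [cite: Balaban1985UV3, (6) p.257; King1986, (3.10) p.656 (bookkeeping)] -/
theorem integral_dressedDensityOfRecord₁₂_zero (θ : Stage12Params F N) (hP : θ.Provisos₁₂ F N) (g₀ : ℕ → ℝ) (os : List (ULoop F)) (t : ℝ)
    (p : B12.RunParams) (g : ℕ → ℝ) :
    ∫ V, dressedDensityOfRecord₁₂ F N θ hP g₀ os t p g 0 V ∂fieldMeasure (F.P p.K) 0 (SU N) =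
      T4GenFunBounds.schemeZ ((datumOfRecord₁₂ F N θ hP).scheme g₀) os p.K t :=
  integral_dressedDensityOfDatum₉_zero F N θ.toStage9Params _ g₀ os t p g

/-- **THE CLASS WEIGHTS OF RECORD, STAGE 12** (`D := datumOfRecord₁₂ F N θ hP`): run A's term weight of one sequence of record at the source `t`.
[cite: Balaban1988Convergent, (2.18) p.257; King1986, (3.10) p.656 (bookkeeping)] -/
def classWeightOfRecord₁₂ (θ : Stage12Params F N) (hP : θ.Provisos₁₂ F N) (g₀ : ℕ → ℝ) (os : List (ULoop F)) (p : B12.RunParams)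
    (g : ℕ → ℝ) (k : ℕ) (t : ℝ) (s : SeqOfRecord F θ.ν θ.τ9.M g p.K k) : ℝ :=
  classWeightOfDatum₉ F N θ.toStage9Params (datumOfRecord₁₂ F N θ hP) g₀ os p g k t s

/-- **E1 AT LEVEL 0 AS A SUM IDENTITY, AT THE STAGE-12 RECORD, NO HYPOTHESIS**: the class weights of the (length-0) sequences of record sum to the dressed
partition function `schemeZ ((datumOfRecord₁₂ F N θ hP).scheme g₀) os p.K t` (integrability at level 0 by `integrable_dressedStart_datumOfRecord₁₂`, `χ_0 ≡ 1`)
— the ₁₂ twin of F3's `sum_classWeightOfRecord₁₁_zero`, now unreachable behind `Node00.not_provisos₁₁`. [cite: Balaban1985UV3, (6) p.257; King1986, (3.10) p.656 (bookkeeping)] -/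
theorem sum_classWeightOfRecord₁₂_zero (θ : Stage12Params F N) (hP : θ.Provisos₁₂ F N) (g₀ : ℕ → ℝ) (os : List (ULoop F)) (t : ℝ)
    (p : B12.RunParams) (g : ℕ → ℝ) :
    ∑ s : SeqOfRecord F θ.ν θ.τ9.M g p.K 0, classWeightOfRecord₁₂ F N θ hP g₀ os p g 0 t s =
      T4GenFunBounds.schemeZ ((datumOfRecord₁₂ F N θ hP).scheme g₀) os p.K t :=
  sum_classWeightOfDatum₉_zero F N θ.toStage9Params _ (isPrintedAveraged_datumOfRecord₁₂ F N θ hP).avgMeasurable g₀ os t p g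

end Literature.MathematicalPhysics.QuantumFieldTheory.Balaban1983to89.Node00

end
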